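import Summits.Ventures.Crystal3D.Bulk.SphSegmentCap
import Summits.Ventures.Crystal3D.Bulk.HexPerimeterDefs
import Literature.Geometry.DiscreteGeometry.SphericalExcessEuler
import Literature.Geometry.DiscreteGeometry.KissingArccosBrackets
import HarnessLib

/-!
# The two common tangent great circles of two `r₀`-caps `60°` apart, their tangent points, and
# the certified constants of the perimeter bound — bricks (S4)+(S8) of (d3)

HONEST FRAMING. Part of the venture `Summits/Ventures/Crystal3D` (cell `pub-crystal3d`, phase 2;
seat typer-bulk-2), configuration-free vector algebra in `ℝ³` plus three certified `arccos`
brackets; nothing here mentions GAP(1.26). In the perimeter proof of the census row (d3)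
(`phase2/theory1/HEX-PERIMETER.md`, plan `HOME/lean/hexper/README.md` S4/S8) the two rattler
directions are replaced by unit vectors `z₁, z₂` with `⟪z₁, z₂⟫ = 1/2` EXACTLY (the sixty-degree
point of `Bulk/SphSegmentCap.lean`), each carrying a cap of angular radius `r₀ = arcsin s`,
`s² = 117/200`, inside the face. This file provides, for unit `z₁, z₂` with `⟪z₁,z₂⟫ = 1/2`
(the two definitions `tangentNormal`, `tangentPoint` live in `Bulk/HexPerimeterDefs.lean`):

* `tangentNormal z₁ z₂ a b = a (z₁ + z₂) + b (z₁ × z₂)` — with `3a/2 = s` and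
  `3a² + (3/4) b² = 1` this is a unit normal of a great circle at distance `r₀` from both centres
  on the same side (`⟪n, z₁⟫ = ⟪n, z₂⟫ = 3a/2`, `orient3 z₁ z₂ n = (3/4) b`,
  `⟪n_b, n_b'⟫ = 3a² + (3/4) b b'`); the two common tangents are `b = ±b₀`;
* `tangentPoint z n s = (z − s n)/√(1 − s²)` — the tangent point of the cap about `z` with the
  circle `n⊥` (`⟪n,z⟫ = s`): unit, on the circle, `⟪z, t⟫ = √(1−s²)`,
  `⟪tangentPoint z₁ n s, tangentPoint z₂ n s⟫ = (⟪z₁,z₂⟫ − s²)/(1 − s²)`; it lies in every closed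
  half-space `{⟪N,·⟫ ≥ 0}` with `s‖N‖ ≤ ⟪N, z⟫` (`inner_tangentPoint_nonneg`); the angle at `z`
  between the tangent points on the two circles equals the angle between `perpTo z n` and
  `perpTo z n'`, whose cosine times `(1 − s²)` is `⟪n,n'⟫ − s²`;
* the constants at `s² = 117/200`: tangent chord cosine `−17/83`, back-sweep cosine `−5/83`;
* **numerics** `two_caps_gt` — `4π/3 + 2·arccos (5/8) < 2·arccos (−17/83) +
  2·(√(117/200)·1000/1001)·arccos (−5/83)` (certified rational brackets of
  `Literature/…/KissingArccosBrackets.lean` evaluated by `norm_num`, and `π < 3.1416`): the hull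
  of the two caps (`346.45°` after the `1001/1000` loss of `Bulk/SphPolarBound.lean`) is longer
  than any census hexagon on the window `D ≥ 5/4` (`≤ 342.64°`).
-/

noncomputable section

namespace Summit.Ventures.Crystal3D

open Literature.Geometry.DiscreteGeometry Real InnerProductGeometry
open scoped InnerProductSpace RealInnerProductSpace

/-! ## Part A. The tangent normals -/

/-- `tangentNormal z₁ z₂ a b = a (z₁ + z₂) + b (z₁ × z₂)` with the cross product `cross3`. -/
theorem tangentNormal_eq (z₁ z₂ : EuclideanSpace ℝ (Fin 3)) (a b : ℝ) :
    tangentNormal z₁ z₂ a b = a • (z₁ + z₂) + b • cross3 z₁ z₂ := rfl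

section Normal

variable {z₁ z₂ : EuclideanSpace ℝ (Fin 3)} (h₁ : ‖z₁‖ = 1) (h₂ : ‖z₂‖ = 1) (h12 : ⟪z₁, z₂⟫ = 1 / 2)
include h₁ h₂ h12

/-- Inner products of the frame `S = z₁ + z₂`, `K = z₁ × z₂`: `⟪S,S⟫ = 3`, `⟪S,K⟫ = ⟪K,S⟫ = 0`,
`⟪K,K⟫ = 3/4`. -/
theorem frame_inner :
    ⟪z₁ + z₂, z₁ + z₂⟫ = 3 ∧ ⟪z₁ + z₂, cross3 z₁ z₂⟫ = 0 ∧ ⟪cross3 z₁ z₂, z₁ + z₂⟫ = 0 ∧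
      ⟪cross3 z₁ z₂, cross3 z₁ z₂⟫ = 3 / 4 := by
  have h11 : ⟪z₁, z₁⟫ = 1 := by rw [real_inner_self_eq_norm_sq, h₁, one_pow]
  have h22 : ⟪z₂, z₂⟫ = 1 := by rw [real_inner_self_eq_norm_sq, h₂, one_pow]
  have h21 : ⟪z₂, z₁⟫ = 1 / 2 := by rw [real_inner_comm]; exact h12
  have hKS : ⟪cross3 z₁ z₂, z₁ + z₂⟫ = 0 := by
    rw [inner_add_right, inner_cross3_self_left, inner_cross3_self_right, add_zero]
  refine ⟨?_, ?_, hKS, ?_⟩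
  · rw [inner_add_left, inner_add_right, inner_add_right, h11, h12, h21, h22]; norm_num
  · rw [real_inner_comm]; exact hKS
  · have h := norm_cross3_sq z₁ z₂
    rw [h₁, h₂, h12] at h
    rw [real_inner_self_eq_norm_sq, h]; norm_num

omit h₂ in
/-- `⟪tangentNormal, z₁⟫ = 3a/2`. -/
theorem inner_tangentNormal_left (a b : ℝ) : ⟪tangentNormal z₁ z₂ a b, z₁⟫ = 3 * a / 2 := by
  have h11 : ⟪z₁, z₁⟫ = 1 := by rw [real_inner_self_eq_norm_sq, h₁, one_pow]
  have h21 : ⟪z₂, z₁⟫ = 1 / 2 := by rw [real_inner_comm]; exact h12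
  rw [tangentNormal_eq, inner_add_left, real_inner_smul_left, real_inner_smul_left, inner_add_left,
    h11, h21, inner_cross3_self_left, mul_zero, add_zero]
  ring

omit h₁ in
/-- `⟪tangentNormal, z₂⟫ = 3a/2`. -/
theorem inner_tangentNormal_right (a b : ℝ) : ⟪tangentNormal z₁ z₂ a b, z₂⟫ = 3 * a / 2 := by
  have h22 : ⟪z₂, z₂⟫ = 1 := by rw [real_inner_self_eq_norm_sq, h₂, one_pow]
  rw [tangentNormal_eq, inner_add_left, real_inner_smul_left, real_inner_smul_left, inner_add_left,
    h12, h22, inner_cross3_self_right, mul_zero, add_zero]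
  ring

/-- `⟪n_{a,b}, n_{a,b'}⟫ = 3a² + (3/4) b b'`. -/
theorem inner_tangentNormal_tangentNormal (a b b' : ℝ) :
    ⟪tangentNormal z₁ z₂ a b, tangentNormal z₁ z₂ a b'⟫ = 3 * a ^ 2 + 3 / 4 * (b * b') := by
  obtain ⟨hSS, hSK, hKS, hKK⟩ := frame_inner h₁ h₂ h12
  rw [tangentNormal_eq, tangentNormal_eq]
  set S := z₁ + z₂
  set K := cross3 z₁ z₂
  simp only [inner_add_left, inner_add_right, real_inner_smul_left, real_inner_smul_right, hSS, hSK,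
    hKS, hKK]
  ring

/-- `‖tangentNormal‖ = 1` when `3a² + (3/4) b² = 1`. -/
theorem norm_tangentNormal {a b : ℝ} (hab : 3 * a ^ 2 + 3 / 4 * b ^ 2 = 1) :
    ‖tangentNormal z₁ z₂ a b‖ = 1 := by
  have hsq : ‖tangentNormal z₁ z₂ a b‖ ^ 2 = 1 := by
    rw [← real_inner_self_eq_norm_sq, inner_tangentNormal_tangentNormal h₁ h₂ h12, ← hab]; ring
  have h0 := norm_nonneg (tangentNormal z₁ z₂ a b)
  nlinarith

/-- `orient3 z₁ z₂ (tangentNormal z₁ z₂ a b) = (3/4) b`: positive iff `b > 0`. -/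
theorem orient3_tangentNormal (a b : ℝ) : orient3 z₁ z₂ (tangentNormal z₁ z₂ a b) = 3 / 4 * b := by
  obtain ⟨-, -, hKS, hKK⟩ := frame_inner h₁ h₂ h12
  rw [← inner_cross3_left, tangentNormal_eq, inner_add_right, real_inner_smul_right, real_inner_smul_right,
    hKS, hKK]
  ring

end Normal

/-! ## Part B. Tangent points -/

section Point

variable {z n : EuclideanSpace ℝ (Fin 3)} {s : ℝ} (hz : ‖z‖ = 1) (hn : ‖n‖ = 1) (hzn : ⟪n, z⟫ = s) (hs : s ^ 2 < 1)
include hz hn hzn hs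

omit hz hs in
/-- The tangent point lies on the great circle `n⊥`. -/
theorem inner_tangentPoint_normal : ⟪tangentPoint z n s, n⟫ = 0 := by
  have hnn : ⟪n, n⟫ = 1 := by rw [real_inner_self_eq_norm_sq, hn, one_pow]
  have hzn' : ⟪z, n⟫ = s := by rw [real_inner_comm]; exact hzn
  rw [tangentPoint, real_inner_smul_left, inner_sub_left, real_inner_smul_left, hzn', hnn]; ring

omit hn in
/-- `⟪z, tangentPoint⟫ = √(1 − s²) = cos r₀`. -/
theorem inner_tangentPoint_center : ⟪z, tangentPoint z n s⟫ = Real.sqrt (1 - s ^ 2) := by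
  have hzz : ⟪z, z⟫ = 1 := by rw [real_inner_self_eq_norm_sq, hz, one_pow]
  have hzn' : ⟪z, n⟫ = s := by rw [real_inner_comm]; exact hzn
  have h1 : 0 < 1 - s ^ 2 := by linarith
  have hpos : 0 < Real.sqrt (1 - s ^ 2) := Real.sqrt_pos.2 h1
  have hY : Real.sqrt (1 - s ^ 2) ^ 2 = 1 - s ^ 2 := Real.sq_sqrt h1.le
  rw [tangentPoint, real_inner_smul_right, inner_sub_right, real_inner_smul_right, hzz, hzn']
  rw [show 1 - s * s = Real.sqrt (1 - s ^ 2) ^ 2 by rw [hY]; ring]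
  field_simp

/-- The tangent point is a unit vector. -/
theorem norm_tangentPoint : ‖tangentPoint z n s‖ = 1 := by
  have hzz : ⟪z, z⟫ = 1 := by rw [real_inner_self_eq_norm_sq, hz, one_pow]
  have hnn : ⟪n, n⟫ = 1 := by rw [real_inner_self_eq_norm_sq, hn, one_pow]
  have hzn' : ⟪z, n⟫ = s := by rw [real_inner_comm]; exact hzn
  have h1 : 0 < 1 - s ^ 2 := by linarith
  have hY : Real.sqrt (1 - s ^ 2) ^ 2 = 1 - s ^ 2 := Real.sq_sqrt h1.le
  have h2 : (1 / Real.sqrt (1 - s ^ 2)) ^ 2 = 1 / (1 - s ^ 2) := by rw [div_pow, one_pow, hY]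
  have hsq : ‖tangentPoint z n s‖ ^ 2 = 1 := by
    rw [← real_inner_self_eq_norm_sq, tangentPoint]
    simp only [real_inner_smul_left, real_inner_smul_right, inner_sub_left, inner_sub_right, hzz, hnn,
      hzn, hzn']
    calc _ = (1 / Real.sqrt (1 - s ^ 2)) ^ 2 * (1 - s ^ 2) := by ring
      _ = 1 := by rw [h2]; field_simp
  have h0 := norm_nonneg (tangentPoint z n s)
  nlinarith

omit hz hn hzn hs in
/-- The tangent point lies in every closed half-space `{⟪N, ·⟫ ≥ 0}` whose boundary great circle
is at distance `≥ r₀` from `z` on the positive side (`s ‖N‖ ≤ ⟪N, z⟫`), for a unit `n` and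
`0 ≤ s`, `s² < 1`. -/
theorem inner_tangentPoint_nonneg (hn1 : ‖n‖ = 1) (hs0 : 0 ≤ s) (hs1 : s ^ 2 < 1) {N : EuclideanSpace ℝ (Fin 3)}
    (hN : s * ‖N‖ ≤ ⟪N, z⟫) : 0 ≤ ⟪N, tangentPoint z n s⟫ := by
  have hpos : 0 < Real.sqrt (1 - s ^ 2) := Real.sqrt_pos.2 (by linarith)
  rw [tangentPoint, real_inner_smul_right, inner_sub_right, real_inner_smul_right]
  apply mul_nonneg (by positivity)
  have hNn : ⟪N, n⟫ ≤ ‖N‖ := by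
    have := real_inner_le_norm N n; rw [hn1, mul_one] at this; exact this
  nlinarith

end Point

/-- **The chord between the tangent points of one circle with the two caps**:
`⟪t₁, t₂⟫ = (⟪z₁,z₂⟫ − s²)/(1 − s²)` for `t_k = tangentPoint z_k n s`, `⟪n, z_k⟫ = s`. -/
theorem inner_tangentPoint_tangentPoint {z₁ z₂ n : EuclideanSpace ℝ (Fin 3)} {s : ℝ} (hn : ‖n‖ = 1)
    (h1 : ⟪n, z₁⟫ = s) (h2 : ⟪n, z₂⟫ = s) (hs : s ^ 2 < 1) :
    ⟪tangentPoint z₁ n s, tangentPoint z₂ n s⟫ = (⟪z₁, z₂⟫ - s ^ 2) / (1 - s ^ 2) := by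
  have hnn : ⟪n, n⟫ = 1 := by rw [real_inner_self_eq_norm_sq, hn, one_pow]
  have h1' : ⟪z₁, n⟫ = s := by rw [real_inner_comm]; exact h1
  have hpos : 0 < 1 - s ^ 2 := by linarith
  have hY : Real.sqrt (1 - s ^ 2) ^ 2 = 1 - s ^ 2 := Real.sq_sqrt hpos.le
  have h2' : (1 / Real.sqrt (1 - s ^ 2)) ^ 2 = 1 / (1 - s ^ 2) := by rw [div_pow, one_pow, hY]
  rw [tangentPoint, tangentPoint]
  simp only [real_inner_smul_left, real_inner_smul_right, inner_sub_left, inner_sub_right, h1', h2,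
    hnn]
  calc _ = (1 / Real.sqrt (1 - s ^ 2)) ^ 2 * (⟪z₁, z₂⟫ - s ^ 2) := by ring
    _ = (⟪z₁, z₂⟫ - s ^ 2) / (1 - s ^ 2) := by rw [h2']; ring

/-- **The direction of a tangent point from the centre is opposite to the direction of the
normal**: `perpTo z (tangentPoint z n s) = −(s/√(1−s²)) • perpTo z n`. -/
theorem perpTo_tangentPoint {z n : EuclideanSpace ℝ (Fin 3)} {s : ℝ} (hz : ‖z‖ = 1) :
    perpTo z (tangentPoint z n s) = (-(s / Real.sqrt (1 - s ^ 2))) • perpTo z n := by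
  have hzz : ⟪z, z⟫ = 1 := by rw [real_inner_self_eq_norm_sq, hz, one_pow]
  rw [perpTo_of_norm_eq_one hz, perpTo_of_norm_eq_one hz, tangentPoint, real_inner_smul_right,
    inner_sub_right, real_inner_smul_right, hzz]
  rw [smul_sub, smul_sub, smul_smul, neg_smul, neg_smul, smul_smul]
  module

/-- Hence the angle at the centre between the tangent points on the two circles is the angle
between the projected normals (`0 < s`, `s² < 1`). -/
theorem angle_perpTo_tangentPoints {z n n' : EuclideanSpace ℝ (Fin 3)} {s : ℝ} (hz : ‖z‖ = 1) (hs0 : 0 < s)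
    (hs1 : s ^ 2 < 1) :
    angle (perpTo z (tangentPoint z n s)) (perpTo z (tangentPoint z n' s)) =
      angle (perpTo z n) (perpTo z n') := by
  have hc : 0 < s / Real.sqrt (1 - s ^ 2) := div_pos hs0 (Real.sqrt_pos.2 (by linarith))
  rw [perpTo_tangentPoint hz, perpTo_tangentPoint hz, neg_smul, neg_smul, angle_neg_neg,
    angle_smul_left_of_pos _ _ hc, angle_smul_right_of_pos _ _ hc]

/-- The cosine of the angle between the projected normals, cleared of denominators:
`cos ∠(perpTo z n, perpTo z n') · (1 − s²) = ⟪n, n'⟫ − s²` for unit `n, n'` at height `s` over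
the unit `z`. -/
theorem cos_angle_perpTo_normals {z n n' : EuclideanSpace ℝ (Fin 3)} {s : ℝ} (hz : ‖z‖ = 1) (hn : ‖n‖ = 1)
    (hn' : ‖n'‖ = 1) (h1 : ⟪z, n⟫ = s) (h2 : ⟪z, n'⟫ = s) :
    Real.cos (angle (perpTo z n) (perpTo z n')) * (1 - s ^ 2) = ⟪n, n'⟫ - s ^ 2 := by
  have h := cos_angle_perpTo_mul hz n n'
  have hn2 : ‖perpTo z n‖ ^ 2 = 1 - s ^ 2 := by rw [norm_perpTo_sq_of_norm_eq_one hz hn, h1]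
  have hn2' : ‖perpTo z n'‖ ^ 2 = 1 - s ^ 2 := by rw [norm_perpTo_sq_of_norm_eq_one hz hn', h2]
  have hprod : ‖perpTo z n‖ * ‖perpTo z n'‖ = 1 - s ^ 2 := by
    have hp : ‖perpTo z n‖ = ‖perpTo z n'‖ := by
      have := hn2.trans hn2'.symm
      nlinarith [norm_nonneg (perpTo z n), norm_nonneg (perpTo z n'),
        sq_nonneg (‖perpTo z n‖ - ‖perpTo z n'‖), sq_nonneg (‖perpTo z n‖ + ‖perpTo z n'‖)]
    rw [hp, ← pow_two, hn2']
  rw [hprod, h1, h2, ← pow_two] at h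
  exact h

/-! ## Part C. The constants at `s² = 117/200` -/

/-- With `⟪z₁,z₂⟫ = 1/2` and `s² = 117/200`: the tangent chord has cosine `−17/83`. -/
theorem tangent_chord_cos {c s : ℝ} (hc : c = 1 / 2) (hs : s ^ 2 = 117 / 200) :
    (c - s ^ 2) / (1 - s ^ 2) = -17 / 83 := by
  rw [hc, hs]; norm_num

/-- With `3a/2 = s`, `s² = 117/200` and the tangency relation `3a² + (3/4)b² = 1`: the two
normals `n_{a,b}, n_{a,−b}` have `⟪n, n'⟫ = 3a² − (3/4)b² = 8s²/3 − 1 = 14/25`, and the back-sweep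
has cosine `(⟪n,n'⟫ − s²)/(1 − s²) = −5/83`. -/
theorem back_sweep_cos {a b s : ℝ} (ha : 3 * a / 2 = s) (hab : 3 * a ^ 2 + 3 / 4 * b ^ 2 = 1)
    (hs : s ^ 2 = 117 / 200) :
    (3 * a ^ 2 + 3 / 4 * (b * -b) - s ^ 2) / (1 - s ^ 2) = -5 / 83 := by
  have ha2 : a ^ 2 = 4 * s ^ 2 / 9 := by rw [← ha]; ring
  have hb2 : 3 / 4 * b ^ 2 = 1 - 4 * s ^ 2 / 3 := by nlinarith
  rw [show 3 * a ^ 2 + 3 / 4 * (b * -b) = 3 * a ^ 2 - 3 / 4 * b ^ 2 by ring, hb2, ha2, hs]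
  norm_num

/-- `0.7648 ≤ √(117/200)`. -/
theorem sqrt_s_ge : (0.7648 : ℝ) ≤ Real.sqrt (117 / 200) := by
  rw [show (0.7648 : ℝ) = Real.sqrt (0.7648 ^ 2) by rw [Real.sqrt_sq (by norm_num)]]
  exact Real.sqrt_le_sqrt (by norm_num)

open KissingLP in
/-- **The certified numerics of (d3) on the census window.** With `s = √(117/200)`:
`4π/3 + 2 arccos (5/8) < 2 arccos (−17/83) + 2 (s · 1000/1001) arccos (−5/83)`
(`342.64° < 346.45°`). -/
theorem two_caps_gt :
    4 * π / 3 + 2 * arccos (5 / 8 : ℝ) <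
      2 * arccos (-17 / 83 : ℝ) + 2 * (Real.sqrt (117 / 200) * 1000 / 1001) * arccos (-5 / 83 : ℝ) := by
  have hT : ((17765 / 10000 : ℚ) : ℝ) ≤ arccos ((-17 / 83 : ℚ) : ℝ) :=
    le_arccos_of_leArccosB (by
      simp only [leArccosB, cosLoQ, Bool.and_eq_true, decide_eq_true_eq]; norm_num)
  have hΨ : ((1630 / 1000 : ℚ) : ℝ) ≤ arccos ((-5 / 83 : ℚ) : ℝ) :=
    le_arccos_of_leArccosB (by
      simp only [leArccosB, cosLoQ, Bool.and_eq_true, decide_eq_true_eq]; norm_num)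
  have hρ : arccos ((5 / 8 : ℚ) : ℝ) ≤ ((8957 / 10000 : ℚ) : ℝ) :=
    arccos_le_of_arccosLeB (by
      simp only [arccosLeB, cosHiQ, Bool.and_eq_true, Bool.or_eq_true, decide_eq_true_eq]; norm_num)
  have hπ := Real.pi_lt_d4
  have hs := sqrt_s_ge
  push_cast at hT hΨ hρ
  have hΨ0 : (0 : ℝ) ≤ arccos (-5 / 83 : ℝ) := arccos_nonneg _
  nlinarith [mul_le_mul hs hΨ (by norm_num) (Real.sqrt_nonneg _)]

/-- Orientation of two tangent points with the pole: `orient3 t_z t_y n = orient3 z y n /(1 − s²)`. -/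
theorem orient3_tangentPoints (z y n : EuclideanSpace ℝ (Fin 3)) (s : ℝ) :
    orient3 (tangentPoint z n s) (tangentPoint y n s) n =
      (1 / Real.sqrt (1 - s ^ 2)) ^ 2 * orient3 z y n := by
  simp only [tangentPoint, orient3, PiLp.smul_apply, PiLp.sub_apply, smul_eq_mul]
  ring

end Summit.Ventures.Crystal3D

end
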